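import Mathlib.AlgebraicGeometry.Modules.Sheaf
import Literature.AlgebraicGeometry.Motives.SupportedSheaves
import HarnessLib

/-!
# The cokernel of multiplication by an integer on an `𝒪_X`-module is supported on its zero locus

Topic: `Literature/AlgebraicGeometry/Modules` (geometric plumbing feeding Grothendieck vanishing
WITH SUPPORTS, `Literature.AlgebraicGeometry.Motives.GrothendieckVanishingProof.vanishingOn` — on a
noetherian space an abelian sheaf supported on a closed subset `Y` has `Hⁱ = 0` for `i > sdim Y`;
Hartshorne, *Algebraic Geometry*, III.2.7 with III.2.10 and II Ex. 1.19–1.20).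

What. Let `X` be a scheme, `M : X.Modules` an `𝒪_X`-module with underlying abelian sheaf
`A = (SheafOfModules.toSheaf X.ringCatSheaf).obj M` (its sections over `U` ARE `Γ(M, U)`), `n : ℤ`,
`e : ℕ`. The quotient `A / nᵉ A = cokernel ((n ^ e : ℤ) • 𝟙 A)` (cokernel in the abelian category
of abelian sheaves on `X`) lives on all of `|X|` but is **supported on the zero locus
`V(n) = X ∖ D(n)` of the global function `n ∈ Γ(X, 𝒪_X)`** (`isSupportedOn_cokernel_zsmul`, for the
predicate `Literature.AlgebraicGeometry.Motives.IsSupportedOn` of `SupportedSheaves.lean`: sections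
over opens disjoint from `V(n)` vanish). Reason: over an open `V ⊆ D(n)`, `n|_V` is a unit of
`Γ(X, V)` (`isUnit_map_of_le_basicOpen`, Mathlib's `RingedSpace.isUnit_res_basicOpen`), so `nᵉ` acts
bijectively on `Γ(M, V)` (`sections_zsmul_bijective_of_le_basicOpen`), and a section of the cokernel
is locally the class of some `t = nᵉ • t' ∈ Γ(M, V)`, which is zero. For a `p`-adic scheme
`𝒳 → Spec W` and `M = Ωʲ_{𝒳/W}`: `Ωʲ/pᵉ` is supported on the special fibre `V(p)`, so Grothendieck
vanishing with supports bounds its cohomology by `dim V(p)` rather than `dim 𝒳`.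

Contents (all `[folklore]`, all proved). On a topological space: if `φ` is onto (resp. injective)
on sections over every open inside `W` then `cokernel φ` (resp. `kernel φ`) is supported on `X ∖ W`
(`isSupportedOn_cokernel_of_surjective`, `isSupportedOn_kernel_of_injective`, `ShortComplex` forms
`isSupportedOn_compl_of_epi_of_surjective`, `isSupportedOn_compl_of_mono_of_injective`, and
`isSupportedOn_compl_of_epi_of_app_eq_zero`). On a scheme: units and bijectivity on `V ⊆ D(r)`
(`isUnit_map_of_le_basicOpen`, `sections_(pow_)smul_bijective_of_le_basicOpen`,
`sections_zsmul_bijective_of_le_basicOpen`); supports on `V(r)` / `V(n)` of quotients and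
subsheaves of `A` killed by `rᵏ` / `nᵉ` (`isSupportedOn_of_epi_of_pow_smul_eq_zero`,
`isSupportedOn_toSheaf_of_pow_smul_eq_zero`, `isSupportedOn_of_epi_of_zsmul_comp_eq_zero`,
`isSupportedOn_of_epi_of_zsmul_id_eq_zero`, `isSupportedOn_of_mono_of_zsmul_id_eq_zero`), the
main `isSupportedOn_cokernel_zsmul` with `isSupportedOn_kernel_zsmul` and the restatements
`isSupportedOn_cokernel_zsmul_compl` (support the `Closeds` `(D(n)).compl`, as `vanishingOn` wants
it), `isSupportedOn_cokernel_zsmul_zeroLocus`, `isSupportedOn_cokernel_natCast_zsmul` (`p : ℕ`); the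
zero locus `X ∖ D(r) = V(r)`
(`compl_basicOpen_eq_zeroLocus`, `isClosed_compl_basicOpen`) and its functoriality
`X ∖ D(n) = f⁻¹(S ∖ D(n))` for `f : X ⟶ S` (`compl_basicOpen_eq_preimage`,
`compl_basicOpen_intCast_eq_preimage`; e.g. the special-fibre locus of `𝒳 → Spec W`).

Mathlib searched (pin v4.32): `RingedSpace.isUnit_res_basicOpen`, `Scheme.preimage_basicOpen_top`,
`Scheme.zeroLocus_singleton`, `IsUnit.smul_bijective`, `Int.cast_smul_eq_zsmul` (used); Mathlib has
no support-of-a-sheaf-as-closed-subset notion and nothing on cokernels of `n • 𝟙`. The case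
`U = ⊤` of `isUnit_map_of_le_basicOpen` is also (with heavy imports) `isUnit_res_of_le_basicOpen`
in `Literature.AlgebraicGeometry.Resolution` (`SaturatedIdealSheaf.lean`).

NOT here: the dimension of the support (`sdim V(n)`, Krull dimension of the special fibre); the
identification of `V(p)` with the image of the special fibre of a `p`-adic scheme; torsion-freeness
(`Mono (n • 𝟙 A)`, see `SectionsTorsionFree.lean`); cohomology.

## References

* R. Hartshorne, *Algebraic Geometry*, GTM 52, Springer (1977), doi:10.1007/978-1-4757-3849-0,
  II.1 Ex. 1.14, 1.19, 1.20 (supports, extension by zero), II.2 (`D(f)`, pp. 70–71), III.2.10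
  (cohomology with supports in a closed subset), III.2.7. [Hartshorne1977]
-/

namespace Literature.AlgebraicGeometry.Modules

open _root_.CategoryTheory _root_.CategoryTheory.Limits Opposite TopologicalSpace
open Literature.AlgebraicGeometry.Motives

universe u

/-! ### Supports of kernels and cokernels on a topological space -/

section TopCat

variable {X : TopCat.{u}} {F G : Sheaf (Opens.grothendieckTopology X) AddCommGrpCat.{u}}

/-- An open subset disjoint from the complement of the open `W` is contained in `W`. [folklore] -/
theorem le_of_disjoint_compl {U W : Opens X} (h : Disjoint (U : Set X) (W : Set X)ᶜ) : U ≤ W :=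
  SetLike.coe_subset_coe.mp (Set.disjoint_compl_right_iff_subset.mp h)

/-- In a complex of abelian sheaves `S.X₁ ⟶ S.X₂ ⟶ S.X₃` with `S.g` an epimorphism, if `S.f`
is onto on sections over every open `V ⊆ W`, then `S.X₃` is supported on `X ∖ W`. [folklore] -/
theorem isSupportedOn_compl_of_epi_of_surjective
    (S : ShortComplex (Sheaf (Opens.grothendieckTopology X) AddCommGrpCat.{u})) [Epi S.g]
    (W : Opens X) (hW : ∀ V : Opens X, V ≤ W → Function.Surjective (S.f.hom.app (op V))) :
    IsSupportedOn S.X₃ (W : Set X)ᶜ := fun U hU s =>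
  Sheaf.eq_zero_of_surjective S U (fun V hVU => hW V (hVU.trans (le_of_disjoint_compl hU))) s

/-- **If a morphism of abelian sheaves `φ : F ⟶ G` is onto on sections over every open `V ⊆ W`,
then `cokernel φ` is supported on `X ∖ W`.** [folklore] -/
theorem isSupportedOn_cokernel_of_surjective (φ : F ⟶ G) (W : Opens X)
    (hW : ∀ V : Opens X, V ≤ W → Function.Surjective (φ.hom.app (op V))) :
    IsSupportedOn (cokernel φ) (W : Set X)ᶜ :=
  isSupportedOn_compl_of_epi_of_surjective
    (ShortComplex.mk φ (cokernel.π φ) (cokernel.condition φ)) W hW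

/-- In a complex of abelian sheaves `S.X₁ ⟶ S.X₂ ⟶ S.X₃` with `S.f` a monomorphism, if `S.g` is
injective on sections over every open `V ⊆ W`, then `S.X₁` is supported on `X ∖ W`. [folklore] -/
theorem isSupportedOn_compl_of_mono_of_injective
    (S : ShortComplex (Sheaf (Opens.grothendieckTopology X) AddCommGrpCat.{u})) [Mono S.f]
    (W : Opens X) (hW : ∀ V : Opens X, V ≤ W → Function.Injective (S.g.hom.app (op V))) :
    IsSupportedOn S.X₁ (W : Set X)ᶜ := fun U hU s => by
  apply Sheaf.injective_of_mono S.f (op U)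
  apply hW U (le_of_disjoint_compl hU)
  rw [map_zero, map_zero, ← Sheaf.comp_hom_app_apply, S.zero]
  rfl

/-- If a morphism of abelian sheaves `φ : F ⟶ G` is injective on sections over every open
`V ⊆ W`, then `kernel φ` is supported on `X ∖ W`. [folklore] -/
theorem isSupportedOn_kernel_of_injective (φ : F ⟶ G) (W : Opens X)
    (hW : ∀ V : Opens X, V ≤ W → Function.Injective (φ.hom.app (op V))) :
    IsSupportedOn (kernel φ) (W : Set X)ᶜ :=
  isSupportedOn_compl_of_mono_of_injective
    (ShortComplex.mk (kernel.ι φ) φ (kernel.condition φ)) W hW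

/-- If an epimorphism of abelian sheaves `π : F ⟶ G` vanishes on the sections of `F` over the
opens `V ⊆ W`, then `G` is supported on `X ∖ W` (sections of `G` lift locally). [folklore] -/
theorem isSupportedOn_compl_of_epi_of_app_eq_zero (π : F ⟶ G) [Epi π] (W : Opens X)
    (hW : ∀ V : Opens X, V ≤ W → ∀ t : F.obj.obj (op V), π.hom.app (op V) t = 0) :
    IsSupportedOn G (W : Set X)ᶜ := fun U hU s => by
  refine Sheaf.eq_zero_of_locally_eq_zero s fun x hx => ?_
  obtain ⟨V, hVU, ⟨t, ht⟩, hxV⟩ := Sheaf.locally_surjective_of_epi π U s x hx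
  refine ⟨V, hVU, hxV, fun i => ?_⟩
  rw [hW V (hVU.trans (le_of_disjoint_compl hU)) t] at ht
  rw [Subsingleton.elim i (homOfLE hVU)]
  exact ht.symm

end TopCat

/-! ### Sections of an `𝒪_X`-module over opens inside a basic open `D(r)` -/

section Scheme

open _root_.AlgebraicGeometry

variable {X : Scheme.{u}}

/-- A section `r ∈ Γ(X, U)` restricts to a unit of `Γ(X, V)` on every open `V ⊆ D(r)`
(Mathlib's `RingedSpace.isUnit_res_basicOpen` is the case `V = D(r)`). [folklore] -/
theorem isUnit_map_of_le_basicOpen {U V : X.Opens} (r : Γ(X, U)) (hV : V ≤ X.basicOpen r) :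
    IsUnit (X.presheaf.map (homOfLE (hV.trans (X.basicOpen_le r))).op r) := by
  have h := (X.toRingedSpace.isUnit_res_basicOpen r).map (X.presheaf.map (homOfLE hV).op).hom
  have e : (X.presheaf.map (homOfLE hV).op).hom (X.presheaf.map (homOfLE (X.basicOpen_le r)).op r)
      = X.presheaf.map (homOfLE (hV.trans (X.basicOpen_le r))).op r := by
    rw [← CommRingCat.comp_apply, ← Functor.map_comp]
    rfl
  exact e ▸ h

variable (M : X.Modules) {G : Sheaf (Opens.grothendieckTopology X) AddCommGrpCat.{u}}

/-- For an `𝒪_X`-module `M`, a section `r ∈ Γ(X, U)` and an open `V ⊆ D(r)`, multiplication by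
`r|_V` is bijective on `Γ(M, V)`. [folklore] -/
theorem sections_smul_bijective_of_le_basicOpen {U V : X.Opens} (r : Γ(X, U))
    (hV : V ≤ X.basicOpen r) :
    Function.Bijective fun s : Γ(M, V) =>
      X.presheaf.map (homOfLE (hV.trans (X.basicOpen_le r))).op r • s :=
  (isUnit_map_of_le_basicOpen r hV).smul_bijective

/-- For an `𝒪_X`-module `M`, a section `r ∈ Γ(X, U)`, `k : ℕ` and an open `V ⊆ D(r)`,
multiplication by `(r|_V) ^ k` is bijective on `Γ(M, V)`. [folklore] -/
theorem sections_pow_smul_bijective_of_le_basicOpen {U V : X.Opens} (r : Γ(X, U))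
    (hV : V ≤ X.basicOpen r) (k : ℕ) :
    Function.Bijective fun s : Γ(M, V) =>
      X.presheaf.map (homOfLE (hV.trans (X.basicOpen_le r))).op r ^ k • s :=
  ((isUnit_map_of_le_basicOpen r hV).pow k).smul_bijective

/-- On the sections of an `𝒪_X`-module, the ring element `(n : Γ(X, V)) ^ e` (`n : ℤ`) acts as the
integer `n ^ e`. [folklore] -/
theorem sections_intCast_pow_smul (n : ℤ) (e : ℕ) (V : X.Opens) (s : Γ(M, V)) :
    (n : Γ(X, V)) ^ e • s = (n ^ e : ℤ) • s := by
  rw [← Int.cast_smul_eq_zsmul Γ(X, V) (n ^ e) s, Int.cast_pow]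

/-- **For an `𝒪_X`-module `M`, an integer `n`, `e : ℕ` and an open `V ⊆ D(n)`, multiplication by
`n ^ e` is bijective on `Γ(M, V)`** (`n|_V` is a unit of `Γ(X, V)`). [folklore] -/
theorem sections_zsmul_bijective_of_le_basicOpen (n : ℤ) (e : ℕ) {V : X.Opens}
    (hV : V ≤ X.basicOpen (n : Γ(X, ⊤))) :
    Function.Bijective fun s : Γ(M, V) => (n ^ e : ℤ) • s := by
  have hu := (isUnit_map_of_le_basicOpen _ hV).pow e
  rw [map_intCast] at hu
  convert hu.smul_bijective (β := Γ(M, V)) using 1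
  exact funext fun s => (sections_intCast_pow_smul M n e V s).symm

/-! ### Supports of quotients killed by a power of a function -/

/-- **A quotient of an `𝒪_X`-module on which a power of `r` acts by zero is supported on the zero
locus `V(r) = X ∖ D(r)`**: if `π : A ⟶ G` is an epimorphism of abelian sheaves out of the abelian
sheaf `A` of `M : X.Modules` with `π ((r|_V) ^ k • s) = 0` for all `s ∈ Γ(M, V)`, `V ⊆ D(r)`, then
`G` is supported on `X ∖ D(r)` (over `V ⊆ D(r)` every section is an `(r|_V) ^ k • s`). [folklore] -/
theorem isSupportedOn_of_epi_of_pow_smul_eq_zero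
    (π : (SheafOfModules.toSheaf X.ringCatSheaf).obj M ⟶ G) [Epi π] {U : X.Opens} (r : Γ(X, U))
    (k : ℕ) (h : ∀ (V : X.Opens) (hV : V ≤ X.basicOpen r) (s : Γ(M, V)),
      π.hom.app (op V) (X.presheaf.map (homOfLE (hV.trans (X.basicOpen_le r))).op r ^ k • s) = 0) :
    IsSupportedOn G (X.basicOpen r : Set X)ᶜ := by
  refine isSupportedOn_compl_of_epi_of_app_eq_zero π (X.basicOpen r) fun V hV t => ?_
  obtain ⟨s, rfl⟩ := (sections_pow_smul_bijective_of_le_basicOpen M r hV k).2 t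
  exact h V hV s

/-- An `𝒪_X`-module killed by `r ^ k` on the opens inside `D(r)` (a fortiori: one killed by
`r ^ k`) has underlying abelian sheaf supported on `V(r) = X ∖ D(r)`. [folklore] -/
theorem isSupportedOn_toSheaf_of_pow_smul_eq_zero {U : X.Opens} (r : Γ(X, U)) (k : ℕ)
    (h : ∀ (V : X.Opens) (hV : V ≤ X.basicOpen r) (s : Γ(M, V)),
      X.presheaf.map (homOfLE (hV.trans (X.basicOpen_le r))).op r ^ k • s = 0) :
    IsSupportedOn ((SheafOfModules.toSheaf X.ringCatSheaf).obj M) (X.basicOpen r : Set X)ᶜ :=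
  isSupportedOn_of_epi_of_pow_smul_eq_zero M (𝟙 _) r k fun V hV s => by rw [h V hV s]; rfl

/-- **A quotient `π : A ⟶ G` of the abelian sheaf `A` of an `𝒪_X`-module with
`(n ^ e • 𝟙 A) ≫ π = 0` is supported on the zero locus `V(n) = X ∖ D(n)` of `n`.** [folklore] -/
theorem isSupportedOn_of_epi_of_zsmul_comp_eq_zero
    (π : (SheafOfModules.toSheaf X.ringCatSheaf).obj M ⟶ G) [Epi π] (n : ℤ) (e : ℕ)
    (h : ((n ^ e : ℤ) • 𝟙 ((SheafOfModules.toSheaf X.ringCatSheaf).obj M)) ≫ π = 0) :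
    IsSupportedOn G (X.basicOpen (n : Γ(X, ⊤)) : Set X)ᶜ := by
  refine isSupportedOn_of_epi_of_pow_smul_eq_zero M π (n : Γ(X, ⊤)) e fun V hV s => ?_
  rw [map_intCast, sections_intCast_pow_smul]
  exact (congr_arg (fun ψ => ψ.hom.app (op V) s) h).trans rfl

/-- A quotient `π : A ⟶ G` of the abelian sheaf `A` of an `𝒪_X`-module with `n ^ e • 𝟙 G = 0`
is supported on `V(n) = X ∖ D(n)` (for `A` itself take `π = 𝟙 A`). [folklore] -/
theorem isSupportedOn_of_epi_of_zsmul_id_eq_zero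
    (π : (SheafOfModules.toSheaf X.ringCatSheaf).obj M ⟶ G) [Epi π] (n : ℤ) (e : ℕ)
    (h : (n ^ e : ℤ) • 𝟙 G = 0) :
    IsSupportedOn G (X.basicOpen (n : Γ(X, ⊤)) : Set X)ᶜ := by
  refine isSupportedOn_of_epi_of_zsmul_comp_eq_zero M π n e ?_
  rw [Preadditive.zsmul_comp, Category.id_comp, ← Category.comp_id π, ← Preadditive.comp_zsmul,
    h, comp_zero]

/-- A subsheaf `ι : G ⟶ A` of the abelian sheaf `A` of an `𝒪_X`-module with `n ^ e • 𝟙 G = 0`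
is supported on `V(n) = X ∖ D(n)`. [folklore] -/
theorem isSupportedOn_of_mono_of_zsmul_id_eq_zero
    (ι : G ⟶ (SheafOfModules.toSheaf X.ringCatSheaf).obj M) [Mono ι] (n : ℤ) (e : ℕ)
    (h : (n ^ e : ℤ) • 𝟙 G = 0) :
    IsSupportedOn G (X.basicOpen (n : Γ(X, ⊤)) : Set X)ᶜ := by
  have w : ι ≫ ((n ^ e : ℤ) • 𝟙 ((SheafOfModules.toSheaf X.ringCatSheaf).obj M)) = 0 := by
    rw [Preadditive.comp_zsmul, Category.comp_id, ← Category.id_comp ι, ← Preadditive.zsmul_comp,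
      h, zero_comp]
  exact isSupportedOn_compl_of_mono_of_injective (ShortComplex.mk ι _ w) _ fun _ hV =>
    (sections_zsmul_bijective_of_le_basicOpen M n e hV).1

/-- **Main statement.** For an `𝒪_X`-module `M` on a scheme `X` with abelian sheaf `A`, `n : ℤ`
and `e : ℕ`, the cokernel `A / nᵉ A = cokernel (n ^ e • 𝟙 A)` (in abelian sheaves on `X`) is
supported on the zero locus `V(n) = X ∖ D(n)` of `n ∈ Γ(X, 𝒪_X)`. [folklore] -/
theorem isSupportedOn_cokernel_zsmul (n : ℤ) (e : ℕ) :
    IsSupportedOn (cokernel ((n ^ e : ℤ) • 𝟙 ((SheafOfModules.toSheaf X.ringCatSheaf).obj M)))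
      (X.basicOpen (n : Γ(X, ⊤)) : Set X)ᶜ :=
  isSupportedOn_of_epi_of_zsmul_comp_eq_zero M (cokernel.π _) n e (cokernel.condition _)

/-- The kernel `A[nᵉ] = kernel (n ^ e • 𝟙 A)` of multiplication by `n ^ e` on the abelian sheaf
of an `𝒪_X`-module is supported on `V(n) = X ∖ D(n)`. [folklore] -/
theorem isSupportedOn_kernel_zsmul (n : ℤ) (e : ℕ) :
    IsSupportedOn (kernel ((n ^ e : ℤ) • 𝟙 ((SheafOfModules.toSheaf X.ringCatSheaf).obj M)))
      (X.basicOpen (n : Γ(X, ⊤)) : Set X)ᶜ :=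
  isSupportedOn_kernel_of_injective _ _ fun _ hV =>
    (sections_zsmul_bijective_of_le_basicOpen M n e hV).1

/-- `isSupportedOn_cokernel_zsmul` with the support written as the closed set `(D(n)).compl :
Closeds X` (the form consumed by `GrothendieckVanishingProof.vanishingOn`). [folklore] -/
theorem isSupportedOn_cokernel_zsmul_compl (n : ℤ) (e : ℕ) :
    IsSupportedOn (cokernel ((n ^ e : ℤ) • 𝟙 ((SheafOfModules.toSheaf X.ringCatSheaf).obj M)))
      ((X.basicOpen (n : Γ(X, ⊤))).compl : Set X) :=
  isSupportedOn_cokernel_zsmul M n e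

/-- `isSupportedOn_cokernel_zsmul` for a natural number `p` (e.g. a prime): the cokernel of
`p ^ e • 𝟙 A` is supported on `V(p) = X ∖ D(p)`. [folklore] -/
theorem isSupportedOn_cokernel_natCast_zsmul (p e : ℕ) :
    IsSupportedOn (cokernel ((↑p ^ e : ℤ) • 𝟙 ((SheafOfModules.toSheaf X.ringCatSheaf).obj M)))
      (X.basicOpen (p : Γ(X, ⊤)) : Set X)ᶜ := by
  simpa only [Int.cast_natCast] using isSupportedOn_cokernel_zsmul M (p : ℤ) e

/-! ### The zero locus `V(r) = X ∖ D(r)` -/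

/-- The complement of the basic open `D(r)` is the zero locus `V(r)` (Mathlib's
`Scheme.zeroLocus`). [folklore] -/
theorem compl_basicOpen_eq_zeroLocus {U : X.Opens} (r : Γ(X, U)) :
    (X.basicOpen r : Set X)ᶜ = X.zeroLocus {r} :=
  (X.zeroLocus_singleton r).symm

/-- The zero locus `X ∖ D(r)` is closed. [folklore] -/
theorem isClosed_compl_basicOpen {U : X.Opens} (r : Γ(X, U)) :
    IsClosed (X.basicOpen r : Set X)ᶜ :=
  (X.basicOpen r).isOpen.isClosed_compl

/-- `isSupportedOn_cokernel_zsmul` with the support written as the zero locus `X.zeroLocus {n}`.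
[folklore] -/
theorem isSupportedOn_cokernel_zsmul_zeroLocus (n : ℤ) (e : ℕ) :
    IsSupportedOn (cokernel ((n ^ e : ℤ) • 𝟙 ((SheafOfModules.toSheaf X.ringCatSheaf).obj M)))
      (X.zeroLocus {(n : Γ(X, ⊤))}) :=
  compl_basicOpen_eq_zeroLocus (X := X) (n : Γ(X, ⊤)) ▸ isSupportedOn_cokernel_zsmul M n e

/-- Functoriality of the zero locus of a global function: for `f : X ⟶ S` and `r₀ ∈ Γ(S, 𝒪_S)`,
`X ∖ D(f^* r₀) = f ⁻¹ (S ∖ D(r₀))` (Mathlib's `Scheme.preimage_basicOpen_top`). [folklore] -/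
theorem compl_basicOpen_eq_preimage {S : Scheme.{u}} (f : X ⟶ S) (r₀ : Γ(S, ⊤)) :
    (X.basicOpen (f.appTop r₀) : Set X)ᶜ = f.base ⁻¹' (S.basicOpen r₀ : Set S)ᶜ := by
  rw [Set.preimage_compl, ← Scheme.preimage_basicOpen_top]
  rfl

/-- For `f : X ⟶ S` and an integer `n`, `X ∖ D(n) = f ⁻¹ (S ∖ D(n))`: the zero locus of `n` on `X`
is the preimage of that of the base (for `𝒳 → Spec W(k)`, `n = p`: the closed point). [folklore] -/
theorem compl_basicOpen_intCast_eq_preimage {S : Scheme.{u}} (f : X ⟶ S) (n : ℤ) :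
    (X.basicOpen (n : Γ(X, ⊤)) : Set X)ᶜ = f.base ⁻¹' (S.basicOpen (n : Γ(S, ⊤)) : Set S)ᶜ := by
  rw [← compl_basicOpen_eq_preimage f, map_intCast]

end Scheme

end Literature.AlgebraicGeometry.Modules
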